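import Literature.Analysis.FluidPDE.AdaptedBackwardKernel
import Literature.Analysis.FluidPDE.ClassicalSolutionRescale
import Literature.Analysis.FluidPDE.DirectionDissipation
import Literature.Analysis.FluidPDE.KatoLocalCovariance
import HarnessLib

/-!
# Viscosity normalisation of the data of `TangentFlowTransfer`
# (route `AdaptedFrequency`, item `TangentFlowTransfer`, stmt-NavierStokesRegularity-10494)

Helper file (all results proved). The tree's Type-I / mild-solution machinery (KNSS 2009 classes
`IsKNSSDriftMild`, `IsTypeIAncientMild`, the compactness `KNSS2009_typeI_rate_compactness_holds`,
…) is written for unit viscosity, while the item is stated for every `ν > 0`. The time dilation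
`u♭(s, x) = ν⁻¹ u(s/ν, x)`, `p♭ = ν⁻² p(s/ν, ·)`, `G♭(s, x) = G(s/ν, x)` (in the tree's vocabulary
`u♭ = ν⁻¹ • stPull ν⁻¹ 1 0 0 u`, `G♭ = stPull ν⁻¹ 1 0 0 G`; Tao 2013, footnote 3) maps viscosity
`ν` to `1`, the time window `[t₀, T)` to `[νt₀, νT)` and the pole `(T, x₀)` to `(νT, x₀)`, and every
clause of the item is covariant:

* `isAdaptedBackwardKernel_viscosity` (`_Ico`): the five kernel clauses, `ν ↦ 1`;
* `gaussian_bounds_viscosity`, `isGaussianComparable_viscosity`: Gaussian comparability, with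
  constants `(c₁ ν^{n/2}, c₂/ν, C₁ ν^{n/2}, C₂/ν)`;
* `adaptedEnstrophy_viscosity`, `adaptedFrequency_viscosity`, `tendsto_adaptedFrequency_viscosity`:
  `H♭(s) = ν⁻² H(s/ν)` and the adapted frequency is invariant, `Λ♭(s) = Λ(s/ν)`;
* `isClassicalNSSolutionOn_viscosity_Ico`, `typeI_bound_viscosity`, `singular_viscosity`:
  classical solutions, the Type-I bound (constant `C/√ν`) and backward singularity of the pole.

References: T. Tao, Anal. PDE 6 (2013) = arXiv:1108.1165, footnote 3 (viscosity normalisation);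
A. Friedman, *PDE of Parabolic Type* (1964), Ch. 1 §8 (adjoint equation).
-/

noncomputable section

open MeasureTheory Set Function Filter TopologicalSpace Metric
open scoped Topology NNReal ENNReal InnerProductSpace Laplacian

namespace Summit.NavierStokesRegularity.NavierStokesRegularity.Theorems

open Literature.Analysis Literature.Analysis.FluidPDE

/-! ### The time dilation -/

section Time

/-- The dilation `s ↦ ν⁻¹ s` pulls `[t₀, T)` back to `[νt₀, νT)` (`ν > 0`). [folklore] -/
theorem preimage_viscTime_Ico {ν : ℝ} (hν : 0 < ν) (t₀ T : ℝ) :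
    (fun r : ℝ => 0 + ν⁻¹ * r) ⁻¹' Ico t₀ T = Ico (ν * t₀) (ν * T) := by
  ext r
  simp only [mem_preimage, mem_Ico, zero_add]
  rw [inv_mul_eq_div, le_div_iff₀ hν, div_lt_iff₀ hν]
  constructor <;> rintro ⟨h1, h2⟩ <;> exact ⟨by linarith, by linarith⟩

/-- The dilation `s ↦ ν⁻¹ s` pulls `(t₁, T)` back to `(νt₁, νT)` (`ν > 0`). [folklore] -/
theorem preimage_viscTime_Ioo {ν : ℝ} (hν : 0 < ν) (t₁ T : ℝ) :
    (fun r : ℝ => 0 + ν⁻¹ * r) ⁻¹' Ioo t₁ T = Ioo (ν * t₁) (ν * T) := by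
  ext r
  simp only [mem_preimage, mem_Ioo, zero_add]
  rw [inv_mul_eq_div, lt_div_iff₀ hν, div_lt_iff₀ hν]
  constructor <;> rintro ⟨h1, h2⟩ <;> exact ⟨by linarith, by linarith⟩

/-- The dilation tends to `T` from below as `s ↑ νT` (`ν > 0`). [folklore] -/
theorem tendsto_viscTime_nhdsLT {ν : ℝ} (hν : 0 < ν) (T : ℝ) :
    Tendsto (fun s : ℝ => 0 + ν⁻¹ * s) (𝓝[<] (ν * T)) (𝓝[<] T) := by
  have hcont : Continuous fun s : ℝ => 0 + ν⁻¹ * s := by fun_prop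
  refine tendsto_nhdsWithin_of_tendsto_nhds_of_eventually_within _ ?_ ?_
  · have := (hcont.tendsto (ν * T)).mono_left (nhdsWithin_le_nhds (s := Iio (ν * T)))
    simpa [hν.ne'] using this
  · filter_upwards [self_mem_nhdsWithin] with s hs
    simp only [mem_Iio, zero_add] at hs ⊢
    rw [inv_mul_eq_div, div_lt_iff₀ hν]; linarith

/-- `T − ν⁻¹ s = ν⁻¹ (νT − s)` (`ν ≠ 0`). [folklore] -/
theorem sub_viscTime {ν : ℝ} (hν : ν ≠ 0) (T s : ℝ) : T - (0 + ν⁻¹ * s) = ν⁻¹ * (ν * T - s) := by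
  field_simp; ring

end Time

/-! ### Kernel clauses -/

section Kernel

variable {E : Type*} [NormedAddCommGroup E] [InnerProductSpace ℝ E] [FiniteDimensional ℝ E]
  [MeasurableSpace E] [BorelSpace E]

omit [FiniteDimensional ℝ E] [MeasurableSpace E] [BorelSpace E] in
/-- The dilated kernel, unfolded: `stPull ν⁻¹ 1 0 0 G s y = G (ν⁻¹ s) y`. [folklore] -/
theorem stPull_visc_apply (ν : ℝ) (G : ℝ → E → ℝ) (s : ℝ) (y : E) :
    stPull ν⁻¹ 1 0 0 G s y = G (0 + ν⁻¹ * s) y := by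
  simp [stPull_apply]

omit [FiniteDimensional ℝ E] [MeasurableSpace E] [BorelSpace E] in
/-- Joint `C²` regularity is preserved by the time dilation. [folklore] -/
theorem contDiffOn_two_uncurry_stPull_visc {S : Set ℝ} {G : ℝ → E → ℝ}
    (h : ContDiffOn ℝ 2 (uncurry G) (S ×ˢ univ)) (ν : ℝ) :
    ContDiffOn ℝ 2 (uncurry (stPull ν⁻¹ 1 0 0 G)) (((fun r => 0 + ν⁻¹ * r) ⁻¹' S) ×ˢ (univ : Set E)) := by
  have hmaps : MapsTo (stAffine ν⁻¹ 1 0 (0 : E)) (((fun r => 0 + ν⁻¹ * r) ⁻¹' S) ×ˢ (univ : Set E))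
      (S ×ˢ univ) := fun z hz => mk_mem_prod (by simpa [stAffine_apply] using hz.1) (mem_univ _)
  exact h.comp (contDiff_stAffine ν⁻¹ 1 0 (0 : E)).contDiffOn hmaps

/-- **The five kernel clauses under the viscosity normalisation `ν ↦ 1`.** If `G` is a
flow-adapted backward kernel of `∂ₜ + u·∇ − νΔ` on `S` with pole `(T, x₀)`, then `G♭ = G(s/ν, ·)`
is a flow-adapted backward kernel of `∂ₜ + u♭·∇ − Δ`, `u♭ = ν⁻¹ u(s/ν, ·)`, on the dilated time set
with pole `(νT, x₀)`: every term of the adjoint equation acquires the factor `ν⁻¹`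
(`∂ₛG♭ = ν⁻¹ ∂ₜG`, `u♭·∇G♭ = ν⁻¹ u·∇G`, `ΔG♭ = ΔG = ν⁻¹ · νΔG`). [folklore] -/
theorem isAdaptedBackwardKernel_viscosity {ν : ℝ} {u : ℝ → E → E} {S : Set ℝ} {T : ℝ} {x₀ : E}
    {G : ℝ → E → ℝ} (hG : IsAdaptedBackwardKernel ν u S T x₀ G) (hν : 0 < ν) :
    IsAdaptedBackwardKernel 1 (ν⁻¹ • stPull ν⁻¹ 1 0 0 u) ((fun r => 0 + ν⁻¹ * r) ⁻¹' S) (ν * T) x₀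
      (stPull ν⁻¹ 1 0 0 G) where
  contDiffOn := contDiffOn_two_uncurry_stPull_visc hG.contDiffOn ν
  pos s hs y := by rw [stPull_visc_apply]; exact hG.pos _ hs _
  adjoint_eq s hs y := by
    have hνi : (ν⁻¹ : ℝ) ≠ 0 := inv_ne_zero hν.ne'
    have ht : 0 + ν⁻¹ * s ∈ S := hs
    have hG2 : ContDiff ℝ 2 (G (0 + ν⁻¹ * s)) := hG.contDiff_slice ht
    have e0 : stPull ν⁻¹ 1 0 (0 : E) G = (1 : ℝ) • stPull ν⁻¹ 1 0 (0 : E) G := (one_smul _ _).symm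
    -- time derivative
    have htime : timeDerivWithin ((fun r => 0 + ν⁻¹ * r) ⁻¹' S) (stPull ν⁻¹ 1 0 (0 : E) G) s y =
        ν⁻¹ * timeDerivWithin S G (0 + ν⁻¹ * s) ((0 : E) + (1 : ℝ) • y) := by
      rw [e0, timeDerivWithin_smul_stPull S G 1 hνi 1 0 (0 : E) s y, smul_eq_mul, one_mul]
    -- drift
    have hdrift : fderiv ℝ (stPull ν⁻¹ 1 0 (0 : E) G s) y ((ν⁻¹ • stPull ν⁻¹ 1 0 0 u) s y) =
        ν⁻¹ * fderiv ℝ (G (0 + ν⁻¹ * s)) ((0 : E) + (1 : ℝ) • y)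
          (u (0 + ν⁻¹ * s) ((0 : E) + (1 : ℝ) • y)) := by
      rw [fderiv_stPull]
      simp only [one_smul, Pi.smul_apply, stPull_apply, map_smul, smul_eq_mul]
    -- Laplacian
    have hlap : (Δ (stPull ν⁻¹ 1 0 (0 : E) G s)) y = (Δ (G (0 + ν⁻¹ * s))) ((0 : E) + (1 : ℝ) • y) := by
      rw [laplacian_stPull ν⁻¹ 1 0 (0 : E) G s y hG2, one_pow, one_smul]
    rw [htime, hdrift, hlap, one_mul]
    have key := hG.adjoint_eq (0 + ν⁻¹ * s) ht ((0 : E) + (1 : ℝ) • y)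
    have : ν⁻¹ * (timeDerivWithin S G (0 + ν⁻¹ * s) (0 + (1 : ℝ) • y) +
        fderiv ℝ (G (0 + ν⁻¹ * s)) (0 + (1 : ℝ) • y) (u (0 + ν⁻¹ * s) (0 + (1 : ℝ) • y)) +
        ν * (Δ (G (0 + ν⁻¹ * s))) (0 + (1 : ℝ) • y)) = 0 := by rw [key, mul_zero]
    have hνν : ν⁻¹ * ν = 1 := inv_mul_cancel₀ hν.ne'
    linear_combination this - ((Δ (G (0 + ν⁻¹ * s))) (0 + (1 : ℝ) • y)) * hνν
  integral_eq_one s hs := by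
    have ht : 0 + ν⁻¹ * s ∈ S := hs
    have h1 : (fun y => stPull ν⁻¹ 1 0 (0 : E) G s y) = G (0 + ν⁻¹ * s) := by
      funext y; simp [stPull_apply]
    rw [h1, hG.integral_eq_one _ ht]
  tendsto_integral_mul φ hφ hφb := by
    have hlim := hG.tendsto_integral_mul φ hφ hφb
    have h1 : (fun s => ∫ y, φ y * stPull ν⁻¹ 1 0 (0 : E) G s y) =
        (fun t => ∫ x, φ x * G t x) ∘ fun s => 0 + ν⁻¹ * s := by
      funext s; simp [stPull_apply]
    rw [h1]
    exact hlim.comp (tendsto_viscTime_nhdsLT hν T)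

/-- The viscosity normalisation of an adapted kernel on `[t₀, T)` is an adapted kernel (unit
viscosity) on `[νt₀, νT)` with pole `(νT, x₀)`. [folklore] -/
theorem isAdaptedBackwardKernel_viscosity_Ico {ν : ℝ} {u : ℝ → E → E} {t₀ T : ℝ} {x₀ : E}
    {G : ℝ → E → ℝ} (hG : IsAdaptedBackwardKernel ν u (Ico t₀ T) T x₀ G) (hν : 0 < ν) :
    IsAdaptedBackwardKernel 1 (ν⁻¹ • stPull ν⁻¹ 1 0 0 u) (Ico (ν * t₀) (ν * T)) (ν * T) x₀
      (stPull ν⁻¹ 1 0 0 G) := by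
  have h := isAdaptedBackwardKernel_viscosity hG hν
  rwa [preimage_viscTime_Ico hν] at h

/-! ### Gaussian comparability -/

omit [FiniteDimensional ℝ E] [MeasurableSpace E] [BorelSpace E] in
/-- The Gaussian profile under the time dilation: for `ν > 0`, `0 ≤ a`,
`K (ν⁻¹ a)^{-n/2} exp(−r/(k ν⁻¹ a)) = (K ν^{n/2}) a^{-n/2} exp(−r/((k/ν) a))`. [folklore] -/
theorem gaussianProfile_viscosity {ν : ℝ} (hν : 0 < ν) (K k r : ℝ) {a : ℝ} (ha : 0 ≤ a) :
    K * (ν⁻¹ * a) ^ (-(Module.finrank ℝ E : ℝ) / 2) * Real.exp (-r / (k * (ν⁻¹ * a))) =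
      (K * ν ^ ((Module.finrank ℝ E : ℝ) / 2)) * a ^ (-(Module.finrank ℝ E : ℝ) / 2) *
        Real.exp (-r / ((k / ν) * a)) := by
  set n := Module.finrank ℝ E
  have hνi : (0 : ℝ) ≤ ν⁻¹ := by positivity
  have hpow : (ν⁻¹ * a) ^ (-(n : ℝ) / 2) = ν ^ ((n : ℝ) / 2) * a ^ (-(n : ℝ) / 2) := by
    rw [Real.mul_rpow hνi ha, Real.inv_rpow hν.le, ← Real.rpow_neg hν.le]
    congr 1; congr 1; ring
  have hexp : k * (ν⁻¹ * a) = (k / ν) * a := by rw [div_eq_mul_inv]; ring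
  rw [hpow, hexp]; ring

omit [FiniteDimensional ℝ E] [MeasurableSpace E] [BorelSpace E] in
/-- **Pointwise Gaussian bounds under the viscosity normalisation**: at `(t, x) = (s/ν, x)` with
`s ≤ νT`, bounds with constants `(c₁, c₂, C₁, C₂)` about `(T, x₀)` become bounds for `G♭` at
`(s, x)` with constants `(c₁ν^{n/2}, c₂/ν, C₁ν^{n/2}, C₂/ν)` about `(νT, x₀)`. [folklore] -/
theorem gaussian_bounds_viscosity {G : ℝ → E → ℝ} {T : ℝ} {x₀ : E} {c₁ c₂ C₁ C₂ : ℝ} {ν : ℝ}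
    (hν : 0 < ν) {s : ℝ} (hs : s ≤ ν * T) (y : E)
    (h : c₁ * (T - (0 + ν⁻¹ * s)) ^ (-(Module.finrank ℝ E : ℝ) / 2) *
          Real.exp (-(‖y - x₀‖ ^ 2) / (c₂ * (T - (0 + ν⁻¹ * s)))) ≤ G (0 + ν⁻¹ * s) y ∧
      G (0 + ν⁻¹ * s) y ≤ C₁ * (T - (0 + ν⁻¹ * s)) ^ (-(Module.finrank ℝ E : ℝ) / 2) *
          Real.exp (-(‖y - x₀‖ ^ 2) / (C₂ * (T - (0 + ν⁻¹ * s))))) :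
    (c₁ * ν ^ ((Module.finrank ℝ E : ℝ) / 2)) * (ν * T - s) ^ (-(Module.finrank ℝ E : ℝ) / 2) *
          Real.exp (-(‖y - x₀‖ ^ 2) / ((c₂ / ν) * (ν * T - s))) ≤ stPull ν⁻¹ 1 0 0 G s y ∧
      stPull ν⁻¹ 1 0 0 G s y ≤
        (C₁ * ν ^ ((Module.finrank ℝ E : ℝ) / 2)) * (ν * T - s) ^ (-(Module.finrank ℝ E : ℝ) / 2) *
          Real.exp (-(‖y - x₀‖ ^ 2) / ((C₂ / ν) * (ν * T - s))) := by
  have ha : (0 : ℝ) ≤ ν * T - s := by linarith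
  rw [sub_viscTime hν.ne'] at h
  rw [stPull_visc_apply, ← gaussianProfile_viscosity hν c₁ c₂ _ ha,
    ← gaussianProfile_viscosity hν C₁ C₂ _ ha]
  exact h

omit [FiniteDimensional ℝ E] [MeasurableSpace E] [BorelSpace E] in
/-- **Two-sided Gaussian comparability under the viscosity normalisation** (new constants
`(c₁ν^{n/2}, c₂/ν, C₁ν^{n/2}, C₂/ν)`), on time sets `S ⊆ (−∞, T]`. [folklore] -/
theorem isGaussianComparable_viscosity {G : ℝ → E → ℝ} {S : Set ℝ} {T : ℝ} {x₀ : E}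
    (h : IsGaussianComparable G S T x₀) (hS : S ⊆ Iic T) {ν : ℝ} (hν : 0 < ν) :
    IsGaussianComparable (stPull ν⁻¹ 1 0 0 G) ((fun r => 0 + ν⁻¹ * r) ⁻¹' S) (ν * T) x₀ := by
  obtain ⟨c₁, c₂, C₁, C₂, h₁, h₂, h₃, h₄, hb⟩ := h
  refine ⟨c₁ * ν ^ ((Module.finrank ℝ E : ℝ) / 2), c₂ / ν, C₁ * ν ^ ((Module.finrank ℝ E : ℝ) / 2),
    C₂ / ν, by positivity, by positivity, by positivity, by positivity, fun s hs y => ?_⟩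
  have ht : 0 + ν⁻¹ * s ∈ S := hs
  have hs0 : s ≤ ν * T := by
    have h1 : 0 + ν⁻¹ * s ≤ T := hS ht
    rw [zero_add, inv_mul_eq_div, div_le_iff₀ hν] at h1; linarith
  exact gaussian_bounds_viscosity hν hs0 y (hb _ ht _)

end Kernel

/-! ### Adapted enstrophy and frequency (`ℝ³`) -/

section Frequency

variable {u : ℝ → EuclideanSpace ℝ (Fin 3) → EuclideanSpace ℝ (Fin 3)}
  {G : ℝ → EuclideanSpace ℝ (Fin 3) → ℝ}

/-- **Adapted enstrophy under the viscosity normalisation**: `H♭(s) = ν⁻² H(s/ν)`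
(`curl u♭ = ν⁻¹ curl u`, same kernel values, no Jacobian). [folklore] -/
theorem adaptedEnstrophy_viscosity (u : ℝ → EuclideanSpace ℝ (Fin 3) → EuclideanSpace ℝ (Fin 3))
    (G : ℝ → EuclideanSpace ℝ (Fin 3) → ℝ) (ν s : ℝ) :
    adaptedEnstrophy (ν⁻¹ • stPull ν⁻¹ 1 0 0 u) (stPull ν⁻¹ 1 0 0 G) s =
      ν⁻¹ ^ 2 * adaptedEnstrophy u G (0 + ν⁻¹ * s) := by
  rw [adaptedEnstrophy_apply, adaptedEnstrophy_apply, ← integral_const_mul]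
  refine integral_congr_ae (Eventually.of_forall fun y => ?_)
  show ‖curl ((ν⁻¹ • stPull ν⁻¹ 1 0 0 u) s) y‖ ^ 2 * stPull ν⁻¹ 1 0 0 G s y =
    ν⁻¹ ^ 2 * (‖curl (u (0 + ν⁻¹ * s)) y‖ ^ 2 * G (0 + ν⁻¹ * s) y)
  rw [curl_smul_stPull, stPull_apply, norm_smul, mul_one, Real.norm_eq_abs, mul_pow, sq_abs]
  simp only [one_smul, zero_add]
  ring

/-- **The adapted frequency is invariant under the viscosity normalisation**:
`Λ♭(s) = Λ(s/ν)` with `Λ♭ = adaptedFrequency u♭ G♭ (νT)`, `Λ = adaptedFrequency u G T` (all junk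
cases included). [folklore] -/
theorem adaptedFrequency_viscosity (u : ℝ → EuclideanSpace ℝ (Fin 3) → EuclideanSpace ℝ (Fin 3))
    (G : ℝ → EuclideanSpace ℝ (Fin 3) → ℝ) (T : ℝ) {ν : ℝ} (hν : 0 < ν) (s : ℝ) :
    adaptedFrequency (ν⁻¹ • stPull ν⁻¹ 1 0 0 u) (stPull ν⁻¹ 1 0 0 G) (ν * T) s =
      adaptedFrequency u G T (0 + ν⁻¹ * s) := by
  have hH : adaptedEnstrophy (ν⁻¹ • stPull ν⁻¹ 1 0 0 u) (stPull ν⁻¹ 1 0 0 G) =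
      fun s => ν⁻¹ ^ 2 * adaptedEnstrophy u G (0 + ν⁻¹ * s) :=
    funext fun s => adaptedEnstrophy_viscosity u G ν s
  have hD : deriv (adaptedEnstrophy (ν⁻¹ • stPull ν⁻¹ 1 0 0 u) (stPull ν⁻¹ 1 0 0 G)) s =
      ν⁻¹ ^ 2 * (ν⁻¹ * deriv (adaptedEnstrophy u G) (0 + ν⁻¹ * s)) := by
    rw [hH, deriv_const_mul_field]
    set H := adaptedEnstrophy u G
    have h1 : (fun s => H (0 + ν⁻¹ * s)) = ((fun r => H (0 + r)) <| ν⁻¹ * ·) := rfl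
    rw [h1, deriv_comp_mul_left ν⁻¹ (fun r => H (0 + r)) s, smul_eq_mul,
      deriv_comp_const_add (f := H) (a := 0) (x := ν⁻¹ * s)]
  rw [adaptedFrequency_apply, adaptedFrequency_apply, hD, adaptedEnstrophy_viscosity]
  set H := adaptedEnstrophy u G (0 + ν⁻¹ * s)
  set H' := deriv (adaptedEnstrophy u G) (0 + ν⁻¹ * s)
  have hν2 : (ν⁻¹ ^ 2 : ℝ) ≠ 0 := by positivity
  rw [show (ν * T - s) * (ν⁻¹ ^ 2 * (ν⁻¹ * H')) = ((T - (0 + ν⁻¹ * s)) * H') * ν⁻¹ ^ 2 by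
      field_simp; ring,
    show ν⁻¹ ^ 2 * H = H * ν⁻¹ ^ 2 by ring, mul_div_mul_right _ _ hν2]

/-- The limit of the adapted frequency transfers: `Λ(t) → Λ₀` as `t ↑ T` gives `Λ♭(s) → Λ₀` as
`s ↑ νT`. [folklore] -/
theorem tendsto_adaptedFrequency_viscosity {T : ℝ} {Λ₀ : ℝ}
    (h : Tendsto (adaptedFrequency u G T) (𝓝[<] T) (𝓝 Λ₀)) {ν : ℝ} (hν : 0 < ν) :
    Tendsto (adaptedFrequency (ν⁻¹ • stPull ν⁻¹ 1 0 0 u) (stPull ν⁻¹ 1 0 0 G) (ν * T))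
      (𝓝[<] (ν * T)) (𝓝 Λ₀) := by
  have h1 : adaptedFrequency (ν⁻¹ • stPull ν⁻¹ 1 0 0 u) (stPull ν⁻¹ 1 0 0 G) (ν * T) =
      adaptedFrequency u G T ∘ fun s => 0 + ν⁻¹ * s :=
    funext fun s => adaptedFrequency_viscosity u G T hν s
  rw [h1]
  exact h.comp (tendsto_viscTime_nhdsLT hν T)

end Frequency

/-! ### Solution clauses -/

section Solution

variable {u : ℝ → EuclideanSpace ℝ (Fin 3) → EuclideanSpace ℝ (Fin 3)}
  {p : ℝ → EuclideanSpace ℝ (Fin 3) → ℝ}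

/-- Classical solutions with viscosity `ν` on `[t₀, T)` become classical solutions with viscosity
`1` on `[νt₀, νT)` (pressure `ν⁻² p(s/ν, ·)`; Tao 2013, footnote 3; the tree's
`IsClassicalNSSolutionOn.stRescale`). [folklore] -/
theorem isClassicalNSSolutionOn_viscosity_Ico {ν t₀ T : ℝ} (hν : 0 < ν)
    (h : IsClassicalNSSolutionOn (Ico t₀ T) ν 0 u p) :
    IsClassicalNSSolutionOn (Ico (ν * t₀) (ν * T)) 1 0 (ν⁻¹ • stPull ν⁻¹ 1 0 0 u)
      ((ν⁻¹) ^ 2 • stPull ν⁻¹ 1 0 0 p) := by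
  have key := h.stRescale (inv_pos.2 hν) one_pos (by rw [mul_one]) 0 (0 : EuclideanSpace ℝ (Fin 3))
  rw [smul_stPull_zero, preimage_viscTime_Ico hν,
    show ν⁻¹ * ν / 1 = (1 : ℝ) by rw [div_one, inv_mul_cancel₀ hν.ne']] at key
  exact key

/-- **The Type-I bound under the viscosity normalisation**: `‖u‖ ≤ C/√(T − t)` on `(t₁, T)` gives
`‖u♭‖ ≤ (C/√ν)/√(νT − s)` on `(νt₁, νT)`. [folklore] -/
theorem typeI_bound_viscosity {T t₁ C : ℝ} (h : ∀ t ∈ Ioo t₁ T, ∀ x, ‖u t x‖ ≤ C / Real.sqrt (T - t))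
    {ν : ℝ} (hν : 0 < ν) :
    ∀ s ∈ Ioo (ν * t₁) (ν * T), ∀ y,
      ‖(ν⁻¹ • stPull ν⁻¹ 1 0 0 u) s y‖ ≤ (C / Real.sqrt ν) / Real.sqrt (ν * T - s) := by
  intro s hs y
  have ht : s ∈ (fun r : ℝ => 0 + ν⁻¹ * r) ⁻¹' Ioo t₁ T := by rw [preimage_viscTime_Ioo hν]; exact hs
  have hb := h _ ht ((0 : EuclideanSpace ℝ (Fin 3)) + (1 : ℝ) • y)
  have hs0 : 0 < ν * T - s := by linarith [hs.2]
  have hC : 0 ≤ C := by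
    have := (norm_nonneg _).trans hb
    exact (div_nonneg_iff.1 this).elim (fun h => h.1) fun h => by
      exfalso; have := Real.sqrt_pos.2 (by rw [sub_viscTime hν.ne']; positivity : (0:ℝ) < T - (0 + ν⁻¹ * s)); linarith [h.2]
  rw [sub_viscTime hν.ne', Real.sqrt_mul' _ hs0.le, Real.sqrt_inv] at hb
  simp only [Pi.smul_apply, stPull_apply, norm_smul, Real.norm_eq_abs, abs_of_pos (inv_pos.2 hν)]
  have hsν : 0 < Real.sqrt ν := Real.sqrt_pos.2 hν
  have hsT : 0 < Real.sqrt (ν * T - s) := Real.sqrt_pos.2 hs0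
  calc ν⁻¹ * ‖u (0 + ν⁻¹ * s) (0 + (1 : ℝ) • y)‖
      ≤ ν⁻¹ * (C / ((Real.sqrt ν)⁻¹ * Real.sqrt (ν * T - s))) :=
        mul_le_mul_of_nonneg_left hb (inv_pos.2 hν).le
    _ = (C / Real.sqrt ν) / Real.sqrt (ν * T - s) := by
        have hνs : (Real.sqrt ν) ^ 2 = ν := Real.sq_sqrt hν.le
        field_simp
        nlinarith [hνs]

/-- **Backward singularity of the pole under the viscosity normalisation**: if `u` is essentially
unbounded on every `Q_r(T, x₀)`, then `u♭` is essentially unbounded on every `Q_r(νT, x₀)`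
(`Q_r(νT, x₀)` is the preimage of `(T − r²/ν, T) × B_r(x₀) ⊇ Q_ρ(T, x₀)`, `ρ = min(r, r/√ν)`).
[folklore] -/
theorem singular_viscosity {T : ℝ} {x₀ : EuclideanSpace ℝ (Fin 3)}
    (h : ∀ r : ℝ, 0 < r → eLpNorm (uncurry u) ⊤
      (volume.restrict (parabolicCylinder r ((T, x₀) : ℝ × EuclideanSpace ℝ (Fin 3)))) = ⊤)
    {ν : ℝ} (hν : 0 < ν) :
    ∀ r : ℝ, 0 < r → eLpNorm (uncurry (ν⁻¹ • stPull ν⁻¹ 1 0 0 u)) ⊤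
      (volume.restrict (parabolicCylinder r ((ν * T, x₀) : ℝ × EuclideanSpace ℝ (Fin 3)))) = ⊤ := by
  intro r hr
  set S₀ : Set (ℝ × EuclideanSpace ℝ (Fin 3)) := Ioo (T - r ^ 2 / ν) T ×ˢ ball x₀ r with hS₀
  have hpre : stAffine ν⁻¹ 1 0 (0 : EuclideanSpace ℝ (Fin 3)) ⁻¹' S₀ =
      parabolicCylinder r ((ν * T, x₀) : ℝ × EuclideanSpace ℝ (Fin 3)) := by
    ext ⟨s, y⟩
    simp only [hS₀, mem_preimage, stAffine_apply, mem_prod, mem_Ioo, mem_parabolicCylinder,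
      zero_add, one_smul, mem_ball]
    rw [inv_mul_eq_div, lt_div_iff₀ hν, div_lt_iff₀ hν]
    constructor
    · rintro ⟨⟨h1, h2⟩, h3⟩
      refine ⟨⟨?_, by linarith⟩, h3⟩
      have : (T - r ^ 2 / ν) * ν = ν * T - r ^ 2 := by field_simp
      linarith
    · rintro ⟨⟨h1, h2⟩, h3⟩
      refine ⟨⟨?_, by linarith⟩, h3⟩
      have : (T - r ^ 2 / ν) * ν = ν * T - r ^ 2 := by field_simp
      linarith
  have h1 : uncurry (ν⁻¹ • stPull ν⁻¹ 1 0 (0 : EuclideanSpace ℝ (Fin 3)) u) =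
      ν⁻¹ • (uncurry u ∘ stAffine ν⁻¹ 1 0 (0 : EuclideanSpace ℝ (Fin 3))) := by
    funext z; rfl
  rw [← hpre, h1, eLpNorm_const_smul,
    eLpNorm_top_comp_stAffine_restrict_preimage (inv_pos.2 hν) one_pos 0 _ (uncurry u) S₀]
  -- `S₀ ⊇ Q_ρ(T, x₀)` with `ρ = min r (r / √ν)`
  set ρ : ℝ := min r (r / Real.sqrt ν) with hρ
  have hρ0 : 0 < ρ := lt_min hr (div_pos hr (Real.sqrt_pos.2 hν))
  have hsub : parabolicCylinder ρ ((T, x₀) : ℝ × EuclideanSpace ℝ (Fin 3)) ⊆ S₀ := by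
    rintro ⟨s, y⟩ hz
    rw [mem_parabolicCylinder] at hz
    obtain ⟨⟨hz1, hz2⟩, hz3⟩ := hz
    have hρr : ρ ≤ r := min_le_left _ _
    have hρν : ρ ^ 2 ≤ r ^ 2 / ν := by
      have h2 : ρ ≤ r / Real.sqrt ν := min_le_right _ _
      have h3 : ρ ^ 2 ≤ (r / Real.sqrt ν) ^ 2 := pow_le_pow_left₀ hρ0.le h2 2
      rwa [div_pow, Real.sq_sqrt hν.le] at h3
    refine ⟨⟨by simp only at hz1 ⊢; linarith, hz2⟩, ?_⟩
    rw [mem_ball]; exact lt_of_lt_of_le hz3 hρr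
  have hmono : eLpNorm (uncurry u) ⊤
      (volume.restrict (parabolicCylinder ρ ((T, x₀) : ℝ × EuclideanSpace ℝ (Fin 3)))) ≤
      eLpNorm (uncurry u) ⊤ (volume.restrict S₀) :=
    eLpNorm_mono_measure _ (Measure.restrict_mono hsub le_rfl)
  rw [h ρ hρ0, top_le_iff] at hmono
  rw [hmono, ENNReal.mul_top (by simpa using hν.ne')]

end Solution

end Summit.NavierStokesRegularity.NavierStokesRegularity.Theorems

end
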